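import Summits.MatrixMultiplication.OmegaCensus.DominoZpZpCover
import Summits.MatrixMultiplication.OmegaCensus.DominoZ5LineTable6
import HarnessLib

/-!
# Kernel covers on `ZMod 5 × ZMod 5`: part `6`

ω-census `pub-omega`, family (b3), seat pub-omega-group gen 22 (generator of gen 20).  Framing: lottery ticket; floor = certified bounds/negative
ranges.  VALUE: the finite kernel computation behind the `ℤ_5 × ℤ_5` domino cell theorems with a part `6` (`DominoZ5Z5Part6.lean`); NOT progress on ω.

Instance of the generic margin-pruned enumeration `DominoZpZpCover.lean` for `(p, d) = (5, 6)` (filed by gen 22 with the gen-20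
generator; g19's bundled parts-6/7 route `DominoZ5Z5NormalForm`/`Cells67` is held by a wedged olean): the search tree of the codes of the
40 UNcertified 1-D multisets (`passTreeZ5d6`, untrusted), its extensional soundness against the certified table `table6` of
`DominoZ5LineTable6.lean` (`passTreeZ5d6_sound`, `decide`), the kernel cover computations (normal form (i) in ONE chunk: 7 970 leaves /
13 010 nodes; (ii): 145 nodes; exact Python twin `pub-omega-group-g20/code/emulate.py 5 6`), and the assembled semantic statement
`exists_table_entry_5_6` consumed by `DominoZ5Z5Part6.lean`.
-/

namespace Summit.MatrixMultiplication.OmegaCensus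

namespace ZpZpDomino

/-- Search tree of the codes `polyBE 7 c` of the 40 UNcertified multisets `c` of size 6 on `ZMod 5`
(complement of the certified table; 210 multisets in all); untrusted, see `passTreeZ5d6_sound`. [folklore] -/
def passTreeZ5d6 : BTree := BTree.ofList [
  2940, 2466, 840, 366, 108, 72, 834, 444, 2430, 1092, 1044, 2454, 2802, 2754, 2556, 2508, 2760, 2844, 2814, 2808,
  2850, 4908, 3192, 3150, 3144, 3102, 3186, 4812, 3780, 3480, 4860, 5208, 5160, 5154, 4950, 5166, 5544, 5538, 5244,
  5880]

set_option maxHeartbeats 4000000 in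
/-- The ONLY fact used about `passTreeZ5d6`: a composition of `6` whose code is unflagged is the key of a table entry
(kernel check over all 210 compositions). [folklore] -/
theorem passTreeZ5d6_sound : soundChk 5 6 passTreeZ5d6 table6 = true := by decide +kernel

set_option maxHeartbeats 4000000 in
/-- Kernel cover computation, `p = 5`, `d = 6`, normal form (i), chunk `0` of `1`. [folklore] -/
theorem cover_5_6_nf1_0 : coverNF1 5 6 passTreeZ5d6 2 1 0 = true := by decide +kernel

set_option maxHeartbeats 4000000 in
/-- Kernel cover computation, `p = 5`, `d = 6`, normal form (ii). [folklore] -/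
theorem cover_5_6_nf2 : coverNF2 5 6 passTreeZ5d6 = true := by decide +kernel

/-- Kernel cover computation, `p = 5`, `d = 6`, normal form (iii). [folklore] -/
theorem cover_5_6_nf3 : coverNF3 5 6 passTreeZ5d6 = true := by decide +kernel

/-- **Every value function of sum `6` on `ZMod 5 × ZMod 5` (as `25` values) in normal form has a line direction
whose count vector is a certified entry of the table.** [folklore] -/
theorem exists_table_entry_5_6 (g : Fin (5 * 5) → ℕ) (hg : ∑ i, g i = 6)
    (hNF : (1 ≤ g ⟨5, by decide⟩ ∧ 1 ≤ g ⟨1, by decide⟩) ∨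
      (1 ≤ g ⟨5, by decide⟩ ∧ ∀ i : Fin (5 * 5), i.val % 5 ≠ 0 → g i = 0) ∨ (∀ i : Fin (5 * 5), i.val ≠ 0 → g i = 0)) :
    ∃ j < 5 + 1, ∃ e ∈ table6, ∀ v < 5, e.1.getD v 0 = ∑ i : Fin (5 * 5), pick v (pv 5 j i.val) (g i) := by
  exact exists_entry_of_cover (p := 5) (by norm_num) _ passTreeZ5d6 (sound_of_soundChk passTreeZ5d6_sound) (K := 2) (m := 1)
    Nat.one_pos (forall_lt_one cover_5_6_nf1_0) cover_5_6_nf2 cover_5_6_nf3 ⟨5, by decide⟩ ⟨1, by decide⟩ rfl rfl g hg hNF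

end ZpZpDomino

end Summit.MatrixMultiplication.OmegaCensus
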